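import Summits.ABC.StewartYu.ArchG3RecLinesD
import Summits.ABC.StewartYu.ArchG3PackClosedV
import HarnessLib

/-!
# The archimedean record `ArchG3Rec` — letter lines in closed form, file E: NODE COUNTS, `L₀`-PRODUCTS, `log WC`, `log DΔC`

Support file (theorems only; no named facts). Cell `abc-stewartyu`, route `YuMatveevShapeRat`, crux r2 `ArchCoreRat`
(stmt-ABC-20502), line `arch-g3-frame`, seam (B) of `stub_recLinesArch` (p5's closed letters of `ArchG3RecLinesClosed`).
* `Cb_ge'`: `86 ≤ C_b`, `2^20 ≤ 48·C_bⁿ·K`; `Amax_div_N_le`: `A_max/N ≤ L/(48C_bⁿK)` (so `Σ A/N ≤ n·L/2^20`), `Σ A ≤ n·L·WN/2^20`;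
* `sum_LνRR_A_le`: `Σⱼ (LνRR lev j/N)·A j ≤ (n·L + ΣA/N)/2^lev ≤ (1 + 2^{-20})·n·L/2^lev` (the exact pairing `(2Bv j+1)·A j/N ≤ L + A j/N`);
* node counts: `Xs s ≤ 2^s·X/2 + 1 ≤ 2^s·X`, `Nf lev ν ≤ 2^{ν+lev}·X`, `Nh lev ≤ 2^lev·X`, `Nf 0 0 ≤ X`;
* `sq_log_le`: `(log N)² ≤ N`; `L₀_logN_le`: `L₀·log N ≤ Z/(2·yload_K) + log N`;
  `L₀_mul_le`: `L₀·(G + (Ŝ+n+11)·log 2 + 1) ≤ (22/100)·Z + (19n + 47 + log N)`;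
* `logWC_le`: for `e ≤ Ŝ` and `0 ≤ ρ ≤ 2^{Ŝ−e}·2^{n+6}·e^G·X`,
  `log WC(H, e, L₀, T', ρ) ≤ T'·Ŝ·log 2 + X/8 + L₀·(G + (Ŝ+n+11)·log 2 + 1)`;
* `logDΔC_le`: `log DΔC(YR lev, Tf lev' ν') ≤ Tf lev' ν'·(WN + log N + log n! + 3·log(n+2) + 1)`.

## References
* [Nesterenko2003] Yu. V. Nesterenko, LNM 1819 (2003) — §3.5 Lemma 3.10 (3.35)–(3.37); §4 (4.3).
-/

noncomputable section

open Finset Real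
open scoped Nat
open Summit.ABC.StewartYu.ArchSupply (WC)
open Summit.ABC.StewartYu.ArchG3Setup (DΔC)

namespace Summit.ABC.StewartYu

namespace ArchG3Rec

open PadicG3Par (Cb Cb_pos)
open ArchG3Par (G K yloadK G_eq G_pos K_pos yloadK_pos two_G_le_yloadK)

variable {n : ℕ} (P : ArchG3Rec n)

/-! ### Constants -/

/-- `86 ≤ C_b` (`C_b = 32e`) and `2^20 ≤ 48·C_bⁿ·K` (`n ≥ 1`, `K ≥ 1`… indeed `K ≥ e^{18}`). [folklore] -/
theorem Cb_ge' (hn : 1 ≤ n) : (86 : ℝ) ≤ Cb ∧ (2 : ℝ) ^ 20 ≤ 48 * Cb ^ n * K n := by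
  have h1 : (86 : ℝ) ≤ Cb := by rw [Cb_eq]; have := Real.exp_one_gt_d9; nlinarith
  refine ⟨h1, ?_⟩
  have hn1 : (1 : ℝ) ≤ n := by exact_mod_cast hn
  have hK : Real.exp (G n + 2) ≤ K n := by
    unfold K; push_cast
    have := Nat.le_ceil ((n : ℝ) * Real.exp (G n + 2))
    nlinarith [Real.exp_pos (G n + 2)]
  have hG : (16 : ℝ) ≤ G n := by rw [G_eq]; linarith
  have he : (2 : ℝ) ^ 20 ≤ Real.exp (G n + 2) := by
    have h14 : (14 : ℝ) ≤ G n + 2 := by linarith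
    have := Real.exp_le_exp.mpr h14
    have h2 : (2 : ℝ) ^ 20 ≤ Real.exp 14 := by
      have := Real.exp_one_gt_d9
      have h3 : Real.exp 14 = Real.exp 1 ^ 14 := by rw [← Real.exp_nat_mul]; norm_num
      rw [h3]
      calc (2 : ℝ) ^ 20 ≤ (2.7 : ℝ) ^ 14 := by norm_num
        _ ≤ Real.exp 1 ^ 14 := pow_le_pow_left₀ (by norm_num) (by linarith) 14
    linarith
  have hCb : (1 : ℝ) ≤ Cb ^ n := one_le_pow₀ (by linarith)
  nlinarith [K_pos n]

/-- **`A_max/N ≤ L/(48·C_bⁿ·K)`** (the core with `WN ≤ N·W`), hence `ΣA/N ≤ n·L/2^20` and `Σ A ≤ n·L·WN/2^20`. [folklore] -/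
theorem Amax_div_N_le : P.Amax / P.N ≤ P.L / (48 * Cb ^ n * K n) ∧ P.SAR / P.N ≤ n * P.L / 2 ^ 20 ∧
    P.SAR ≤ n * P.L * P.WN / 2 ^ 20 := by
  have hcore := P.core_le_L.1
  have hWN := P.WN_le_N_W
  have hWN1 := P.WN_bounds.1
  have hN := P.N_facts
  have hy := two_G_le_yloadK n
  have hG := G_pos n
  have hW := P.hW
  obtain ⟨hΩ0, -, hAΩ, -⟩ := P.Ω_facts
  obtain ⟨hS, -, hS0⟩ := P.SAR_le
  have hc := (Cb_ge' P.hn).2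
  have hCK : 0 < 48 * Cb ^ n * K n := lt_of_lt_of_le (by positivity) hc
  have hL : (0 : ℝ) ≤ P.L := Nat.cast_nonneg _
  -- `48 C_bⁿ K Ω W ≤ L WN W`?  precisely: `24C_bⁿΩK·2G·W ≤ 24C_bⁿΩK·yloadK·W ≤ G·WN·L ≤ G·N·W·L`
  have h1 : 48 * Cb ^ n * K n * P.Ω ≤ P.L * P.N := by
    have hcoef : 0 ≤ 24 * Cb ^ n * P.Ω * K n := by have := Cb_pos; have := K_pos n; positivity
    have h2 : 24 * Cb ^ n * P.Ω * K n * (2 * G n) * P.W ≤ G n * (P.N * P.W) * P.L := by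
      calc 24 * Cb ^ n * P.Ω * K n * (2 * G n) * P.W ≤ 24 * Cb ^ n * P.Ω * K n * yloadK n * P.W := by gcongr
        _ ≤ G n * P.WN * P.L := hcore
        _ ≤ G n * (P.N * P.W) * P.L := by gcongr
    have hW0 : (0 : ℝ) < G n * P.W := by positivity
    nlinarith
  have hA : P.Amax / P.N ≤ P.L / (48 * Cb ^ n * K n) := by
    rw [div_le_div_iff₀ hN.1 hCK]; nlinarith
  have hS2 : P.SAR / P.N ≤ n * P.L / 2 ^ 20 := by
    have hn : (0 : ℝ) ≤ n := Nat.cast_nonneg n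
    calc P.SAR / P.N ≤ n * P.Ω / P.N := div_le_div_of_nonneg_right hS hN.1.le
      _ = n * (P.Ω / P.N) := by ring
      _ ≤ n * (P.L / 2 ^ 20) := by
          apply mul_le_mul_of_nonneg_left _ hn
          rw [div_le_div_iff₀ hN.1 (by positivity)]; nlinarith
      _ = n * P.L / 2 ^ 20 := by ring
  refine ⟨hA, hS2, ?_⟩
  -- `Ω ≤ L·WN/(48C_bⁿK) ≤ L·WN/2^20`
  have hΩ := P.Omega_le_L_WN
  have hn : (0 : ℝ) ≤ n := Nat.cast_nonneg n
  have h3 : P.Ω ≤ P.L * P.WN / 2 ^ 20 := by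
    rw [le_div_iff₀ (by positivity)]; nlinarith
  calc P.SAR ≤ n * P.Ω := hS
    _ ≤ n * (P.L * P.WN / 2 ^ 20) := mul_le_mul_of_nonneg_left h3 hn
    _ = n * P.L * P.WN / 2 ^ 20 := by ring

/-- **the virtual schedule against the weights, exact pairing**: `Σⱼ (LνRR lev j/N)·A j ≤ (n·L + ΣA/N)/2^lev ≤ (1 + 2^{-20})·n·L/2^lev`.
[folklore] -/
theorem sum_LνRR_A_le (lev : ℕ) : ∑ j, (P.LνRR lev j : ℝ) / P.N * P.A j ≤ (n * P.L + P.SAR / P.N) / 2 ^ lev ∧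
    ∑ j, (P.LνRR lev j : ℝ) / P.N * P.A j ≤ (1 + 1 / 2 ^ 20) * n * P.L / 2 ^ lev := by
  have hN := P.N_facts.1
  have hS := P.Amax_div_N_le.2.1
  have h1 : ∀ j, (P.LνRR lev j : ℝ) / P.N * P.A j ≤ (P.L + P.A j / P.N) / 2 ^ lev := by
    intro j
    obtain ⟨-, hb, -, -⟩ := P.Bv_real j
    have hA0 := (P.A_facts j).1
    have h2 : (P.LνRR lev j : ℝ) ≤ (2 * (P.Bv j : ℝ) + 1) / 2 ^ lev := by
      unfold LνRR
      have := Nat.cast_div_le (m := 2 * P.Bv j + 1) (n := 2 ^ lev) (α := ℝ)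
      push_cast at this; exact this
    have h3 : (2 * (P.Bv j : ℝ) + 1) * P.A j / P.N ≤ P.L + P.A j / P.N := by
      have h4 : (2 * (P.Bv j : ℝ) + 1) * P.A j ≤ P.N * P.L + P.A j := by
        have := mul_le_mul_of_nonneg_right hb hA0.le
        have e : P.N * P.L / (2 * P.A j) * P.A j = P.N * P.L / 2 := by field_simp
        nlinarith
      calc (2 * (P.Bv j : ℝ) + 1) * P.A j / P.N ≤ (P.N * P.L + P.A j) / P.N := div_le_div_of_nonneg_right h4 hN.le
        _ = P.L + P.A j / P.N := by field_simp
    calc (P.LνRR lev j : ℝ) / P.N * P.A j ≤ (2 * (P.Bv j : ℝ) + 1) / 2 ^ lev / P.N * P.A j := by gcongr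
      _ = ((2 * (P.Bv j : ℝ) + 1) * P.A j / P.N) / 2 ^ lev := by ring
      _ ≤ (P.L + P.A j / P.N) / 2 ^ lev := div_le_div_of_nonneg_right h3 (by positivity)
  have h5 : ∑ j, (P.LνRR lev j : ℝ) / P.N * P.A j ≤ (n * P.L + P.SAR / P.N) / 2 ^ lev := by
    calc ∑ j, (P.LνRR lev j : ℝ) / P.N * P.A j ≤ ∑ j, (P.L + P.A j / P.N) / 2 ^ lev := sum_le_sum fun j _ => h1 j
      _ = (n * P.L + P.SAR / P.N) / 2 ^ lev := by
          rw [← sum_div, sum_add_distrib, sum_const, card_univ, Fintype.card_fin, nsmul_eq_mul, ← sum_div]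
          rfl
  refine ⟨h5, h5.trans ?_⟩
  apply div_le_div_of_nonneg_right _ (by positivity)
  have hL : (0 : ℝ) ≤ P.L := Nat.cast_nonneg _
  nlinarith

/-! ### Node counts -/

/-- **node counts**: `Xs s ≤ 2^s·X/2 + 1 ≤ 2^s·X`, `Nf lev ν ≤ 2^{ν+lev}·X`, `Nh lev ≤ 2^lev·X`, `Nf 0 0 ≤ X`, `1 ≤ Xs s`. [cite: Nesterenko2003, (4.3)] -/
theorem nodes_le (lev ν : ℕ) : (P.Xs lev : ℝ) ≤ 2 ^ lev * P.X ∧ (P.Nf lev ν : ℝ) ≤ 2 ^ (ν + lev) * P.X ∧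
    (P.Nh lev : ℝ) ≤ 2 ^ lev * P.X ∧ (P.Nf 0 0 : ℝ) ≤ P.X ∧ (1 : ℝ) ≤ P.Xs lev := by
  have hX := P.X_floors.2.1
  have hd := P.Xs_le_dbl lev
  have h1 : (P.Xs lev : ℝ) ≤ 2 ^ lev * P.X := by
    have h2 : (1 : ℝ) ≤ 2 ^ lev * P.X / 2 := by
      have : (1 : ℝ) ≤ 2 ^ lev := one_le_pow₀ (by norm_num)
      rw [le_div_iff₀ (by norm_num)]; nlinarith
    linarith
  have h3 : (P.Nf lev ν : ℝ) ≤ 2 ^ (ν + lev) * P.X := by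
    unfold Nf; push_cast; rw [pow_add]
    have : (0 : ℝ) ≤ 2 ^ ν := by positivity
    nlinarith
  have h4 : (P.Nf 0 0 : ℝ) ≤ P.X := by
    have h5 := P.Xs_le_dbl 0
    simp only [pow_zero, one_mul] at h5
    have e : ((P.Nf 0 0 : ℕ) : ℝ) = P.Xs 0 := by unfold Nf; simp
    rw [e]; linarith
  exact ⟨h1, h3, by unfold Nh; exact h1, h4, by exact_mod_cast (P.Xs_cap_facts lev).1⟩

/-! ### `L₀`-products -/

/-- `(log N)² ≤ N` for `N ≥ 1` (`x² ≤ (1 + x/4)⁴ ≤ e^x`, `(x+4)⁴ − 256x² = (x−4)²(x²+24x+16)`). [folklore] -/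
theorem sq_log_le {N : ℝ} (hN : 1 ≤ N) : Real.log N ^ 2 ≤ N := by
  set x := Real.log N with hx
  have hx0 : 0 ≤ x := Real.log_nonneg hN
  have h1 : x ^ 2 ≤ (1 + x / 4) ^ 4 := by
    have h2 : (x + 4) ^ 4 - 256 * x ^ 2 = (x - 4) ^ 2 * (x ^ 2 + 24 * x + 16) := by ring
    have h3 : 0 ≤ (x - 4) ^ 2 * (x ^ 2 + 24 * x + 16) := mul_nonneg (sq_nonneg _) (by positivity)
    have e : (1 + x / 4) ^ 4 = (x + 4) ^ 4 / 256 := by ring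
    rw [e, le_div_iff₀ (by norm_num)]; linarith
  have h4 : 1 + x / 4 ≤ Real.exp (x / 4) := by have := Real.add_one_le_exp (x / 4); linarith
  have h5 : (1 + x / 4) ^ 4 ≤ Real.exp (x / 4) ^ 4 := pow_le_pow_left₀ (by positivity) h4 4
  have h6 : Real.exp (x / 4) ^ 4 = N := by
    rw [← Real.exp_nat_mul]; norm_num
    have : 4 * (x / 4) = x := by ring
    rw [this, hx, Real.exp_log (by linarith)]
  linarith

/-- **`L₀·log N ≤ Z/(2·yload_K) + log N`** (`L₀ ≤ core/N + 1`, `core·log N/N ≤ Z·(WN·log N/(N·W))/(4 yload_K)`,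
`(W + log N)·log N ≤ 2·N·W`). [folklore] -/
theorem L₀_logN_le : (P.L₀ : ℝ) * Real.log P.N ≤ P.Z / (2 * yloadK n) + Real.log P.N := by
  obtain ⟨hL0, -, -⟩ := P.L₀_real_le
  have hcore := P.core_le_L.1
  have hN := P.N_facts
  have hy := yloadK_pos n
  have hG := G_pos n
  have hW := P.hW
  have hX : (0 : ℝ) ≤ P.X := Nat.cast_nonneg _
  have hlog := hN.2.2
  -- `(W + log N) log N ≤ 2 N W`
  have hsq := sq_log_le hN.2.1
  have hl1 : Real.log (P.N : ℝ) ≤ P.N - 1 := Real.log_le_sub_one_of_pos hN.1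
  have hkey : P.WN * Real.log P.N ≤ 2 * (P.N * P.W) := by
    unfold WN; nlinarith
  -- `6XC_bⁿΩK·log N/N ≤ Z/(2 yloadK)`: from `24C_bⁿΩK yloadK W ≤ G WN L`, times `X log N/(4N)`
  have h1 : 6 * P.X * Cb ^ n * P.Ω * K n / P.N * Real.log P.N ≤ P.Z / (2 * yloadK n) := by
    rw [div_mul_eq_mul_div, div_le_div_iff₀ hN.1 (by positivity)]
    unfold Z
    -- `6 X C Ω K log N · 2y ≤ G X L N`:  `24 C Ω K y W ≤ G WN L` ⇒ `24 C Ω K y W log N ≤ G L (WN log N) ≤ 2 G L N W`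
    have h2 : 24 * Cb ^ n * P.Ω * K n * yloadK n * P.W * Real.log P.N ≤ G n * P.L * (2 * (P.N * P.W)) := by
      have := mul_le_mul_of_nonneg_right hcore hlog
      have hGL : (0 : ℝ) ≤ G n * P.L := by have := P.L_real.2.1; positivity
      nlinarith [mul_le_mul_of_nonneg_left hkey hGL]
    have hW0 : (0 : ℝ) < P.W := by linarith
    nlinarith [mul_le_mul_of_nonneg_left h2 hX]
  have h3 : (P.L₀ : ℝ) * Real.log P.N ≤ (6 * P.X * Cb ^ n * P.Ω * K n / P.N + 1) * Real.log P.N :=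
    mul_le_mul_of_nonneg_right hL0 hlog
  nlinarith

/-- **the `L₀`-product of the Hasse-weight size**: `L₀·(G + (Ŝ+n+11)·log 2 + 1) ≤ (22/100)·Z + (19n + 47 + log N)`
(`L₀ ≤ Z/(4 yload_K) + 1`, `L₀ log N ≤ Z/(2 yload_K) + log N`, `yload_K ≥ 3G + 26`, `Ŝ log 2 ≤ 10n + 29 + log N`). [folklore] -/
theorem L₀_mul_le (hn2 : 2 ≤ n) : (P.L₀ : ℝ) * (G n + (P.Sd + n + 11) * Real.log 2 + 1) ≤
    22 / 100 * P.Z + (19 * n + 47 + Real.log P.N) := by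
  obtain ⟨-, -, hL0⟩ := P.L₀_real_le
  have hLN := P.L₀_logN_le
  have hSd := P.Sd_log_le.2
  have hy := yloadK_ge P.hn
  have hy0 := yloadK_pos n
  have hZ := P.Z_floors.1
  have hlog := P.N_facts.2.2
  have hl2 : Real.log 2 ≤ 0.6932 := by have := Real.log_two_lt_d9; linarith
  have hl2' : 0 < Real.log 2 := Real.log_pos one_lt_two
  have hn : (2 : ℝ) ≤ n := by exact_mod_cast hn2
  have hL00 : (0 : ℝ) ≤ P.L₀ := Nat.cast_nonneg _
  rw [G_eq] at hy ⊢
  -- the multiplier without `log N`: `m := 8(n+1) + (n+11) log 2 + 1 + (10 n + 29) ≤ 18.7 n + 45.7`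
  have hm : (8 : ℝ) * (n + 1) + (P.Sd + n + 11) * Real.log 2 + 1 ≤ 18.7 * n + 45.7 + Real.log P.N := by
    have hn0 : (0 : ℝ) ≤ n := by linarith
    nlinarith
  have h1 : (P.L₀ : ℝ) * ((8 : ℝ) * (n + 1) + (P.Sd + n + 11) * Real.log 2 + 1) ≤
      P.L₀ * (18.7 * n + 45.7) + P.L₀ * Real.log P.N := by nlinarith
  -- `L₀ (18.7n+45.7) ≤ (Z/(4y) + 1)(18.7 n + 45.7)` and `L₀ log N ≤ Z/(2y) + log N`
  have h2 : (P.L₀ : ℝ) * (18.7 * n + 45.7) ≤ (P.Z / (4 * yloadK n) + 1) * (18.7 * n + 45.7) :=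
    mul_le_mul_of_nonneg_right hL0 (by positivity)
  -- `(18.7n + 45.7)/(4y) + 1/(2y) ≤ 0.22` as `y ≥ 24 n + 50` and `n ≥ 2`
  have h3 : P.Z / (4 * yloadK n) * (18.7 * n + 45.7) + P.Z / (2 * yloadK n) ≤ 22 / 100 * P.Z := by
    rw [div_mul_eq_mul_div, div_add_div _ _ (by positivity) (by positivity), div_le_iff₀ (by positivity)]
    have : P.Z * (18.7 * n + 45.7) * (2 * yloadK n) + P.Z * (4 * yloadK n) ≤ 22 / 100 * P.Z * (4 * yloadK n * (2 * yloadK n)) := by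
      have h4 : (18.7 * n + 45.7) * 2 + 4 ≤ 22 / 100 * 8 * yloadK n := by nlinarith
      nlinarith [mul_le_mul_of_nonneg_left h4 (show 0 ≤ P.Z * yloadK n by positivity)]
    linarith
  nlinarith

/-! ### The Hasse-weight size -/

/-- **`log WC(H, e, L₀, T', ρ) ≤ T'·Ŝ·log 2 + X/8 + L₀·(G + (Ŝ+n+11)·log 2 + 1)`** for `e ≤ Ŝ` and
`0 ≤ ρ ≤ 2^{Ŝ−e}·2^{n+6}·e^G·X` (`H ≥ X/16`, so `2^e ρ/H ≤ 2^{Ŝ+n+10} e^G`). [cite: Nesterenko2003, §3.5 Lemma 3.10 (3.35)] -/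
theorem logWC_le {e : ℕ} (he : e ≤ P.Sd) (T' : ℕ) {ρ : ℝ} (hρ0 : 0 ≤ ρ)
    (hρ : ρ ≤ 2 ^ (P.Sd - e) * (2 : ℝ) ^ (n + 6) * Real.exp (G n) * P.X) :
    Real.log (WC P.H e P.L₀ T' ρ) ≤ T' * (P.Sd * Real.log 2) + P.X / 8 + P.L₀ * (G n + (P.Sd + n + 11) * Real.log 2 + 1) := by
  obtain ⟨hH1, hHle, hHge⟩ := P.H_bounds
  have hH1n : 1 ≤ P.H := P.end_floors.2.2
  rw [ArchSupply.log_WC hH1n e P.L₀ T' hρ0]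
  have hl2 : 0 < Real.log 2 := Real.log_pos one_lt_two
  have hX := P.X_floors.2.1
  have hH0 : (0 : ℝ) < P.H := by linarith
  -- first term
  have h1 : ((e * T' : ℕ) : ℝ) * Real.log 2 ≤ T' * (P.Sd * Real.log 2) := by
    push_cast
    have : (e : ℝ) ≤ P.Sd := by exact_mod_cast he
    have hT : (0 : ℝ) ≤ T' := Nat.cast_nonneg _
    have := mul_le_mul_of_nonneg_right (mul_le_mul_of_nonneg_right this hT) hl2.le
    linarith
  -- second term: `H/e ≤ H ≤ X/8`
  have h2 : (P.H : ℝ) / Real.exp 1 ≤ P.X / 8 := by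
    have he1 : (1 : ℝ) ≤ Real.exp 1 := Real.one_le_exp (by norm_num)
    have hy : G n * P.X / (64 * (n + 1)) = (P.X : ℝ) / 8 := by rw [G_eq]; field_simp; ring
    calc (P.H : ℝ) / Real.exp 1 ≤ P.H := div_le_self hH0.le he1
      _ ≤ P.X / 8 := by rw [← hy]; exact hHle
  -- third term: `1 + 2^e ρ/H ≤ 2^{Ŝ+n+11} e^G`
  have hy2 : G n * P.X / (128 * (n + 1)) = (P.X : ℝ) / 16 := by rw [G_eq]; field_simp; ring
  rw [hy2] at hHge
  have h3 : 1 + (2 : ℝ) ^ e * ρ / P.H ≤ (2 : ℝ) ^ (P.Sd + n + 11) * Real.exp (G n) := by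
    have h4 : (2 : ℝ) ^ e * ρ ≤ 2 ^ P.Sd * (2 : ℝ) ^ (n + 6) * Real.exp (G n) * P.X := by
      calc (2 : ℝ) ^ e * ρ ≤ 2 ^ e * (2 ^ (P.Sd - e) * (2 : ℝ) ^ (n + 6) * Real.exp (G n) * P.X) :=
            mul_le_mul_of_nonneg_left hρ (by positivity)
        _ = (2 ^ e * 2 ^ (P.Sd - e)) * (2 : ℝ) ^ (n + 6) * Real.exp (G n) * P.X := by ring
        _ = 2 ^ P.Sd * (2 : ℝ) ^ (n + 6) * Real.exp (G n) * P.X := by rw [← pow_add, Nat.add_sub_cancel' he]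
    have h5 : (2 : ℝ) ^ e * ρ / P.H ≤ 2 ^ P.Sd * (2 : ℝ) ^ (n + 6) * Real.exp (G n) * 16 := by
      rw [div_le_iff₀ hH0]
      have : (0 : ℝ) ≤ 2 ^ P.Sd * (2 : ℝ) ^ (n + 6) * Real.exp (G n) := by positivity
      nlinarith
    have he1 : (1 : ℝ) ≤ Real.exp (G n) := Real.one_le_exp (G_pos n).le
    have e2 : (2 : ℝ) ^ (P.Sd + n + 11) = 2 ^ P.Sd * 2 ^ (n + 6) * 16 * 2 := by
      rw [show P.Sd + n + 11 = P.Sd + (n + 6) + 4 + 1 by omega, pow_add, pow_add, pow_add]; norm_num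
    rw [e2]
    have : (1 : ℝ) ≤ 2 ^ P.Sd * 2 ^ (n + 6) * 16 * Real.exp (G n) := by
      have h6 : (1 : ℝ) ≤ 2 ^ P.Sd * 2 ^ (n + 6) * 16 :=
        one_le_mul_of_one_le_of_one_le (one_le_mul_of_one_le_of_one_le (one_le_pow₀ (by norm_num)) (one_le_pow₀ (by norm_num)))
          (by norm_num)
      nlinarith
    nlinarith
  have h7 : Real.log (1 + (2 : ℝ) ^ e * ρ / P.H) ≤ (P.Sd + n + 11) * Real.log 2 + G n := by
    have hpos : 0 < 1 + (2 : ℝ) ^ e * ρ / P.H := by positivity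
    calc Real.log (1 + (2 : ℝ) ^ e * ρ / P.H) ≤ Real.log ((2 : ℝ) ^ (P.Sd + n + 11) * Real.exp (G n)) :=
          Real.log_le_log hpos h3
      _ = (P.Sd + n + 11) * Real.log 2 + G n := by
          rw [Real.log_mul (by positivity) (Real.exp_pos _).ne', Real.log_pow, Real.log_exp]; push_cast; ring
  have hL00 : (0 : ℝ) ≤ P.L₀ := Nat.cast_nonneg _
  have h8 : (P.L₀ : ℝ) * (1 + Real.log (1 + (2 : ℝ) ^ e * ρ / P.H)) ≤ P.L₀ * (G n + (P.Sd + n + 11) * Real.log 2 + 1) :=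
    mul_le_mul_of_nonneg_left (by linarith) hL00
  linarith

/-! ### The Δ-weight -/

/-- **`log DΔC(YR lev, Tf lev' ν') ≤ Tf lev' ν'·(WN + log N + log n! + 3·log(n+2) + 1)`** (`Tf ≥ 8(n+1)L/(n+2)³`,
`YR ≤ 10·n·n!·Bexp·N²·L`, so `1 + YR/Tf ≤ (9/4)(n+2)³·n!·Bexp·N²`, `log Bexp = W − 1`). [cite: Nesterenko2003, (3.37); shape only] -/
theorem logDΔC_le (lev lev' ν' : ℕ) : Real.log (DΔC (P.YR lev) (P.Tf lev' ν')) ≤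
    P.Tf lev' ν' * (P.WN + Real.log P.N + Real.log (n ! : ℝ) + 3 * Real.log ((n : ℝ) + 2) + 1) := by
  obtain ⟨hY0, hY⟩ := P.YR_le lev
  obtain ⟨hT8, hT1⟩ := P.Tf_ge lev' ν'
  have hN := P.N_facts
  have hL := P.L_real
  rw [ArchG3Setup.log_DΔC hY0]
  have hT0 : (0 : ℝ) < P.Tf lev' ν' := by linarith
  have hn0 : (0 : ℝ) ≤ n := Nat.cast_nonneg n
  have hn1 : (1 : ℝ) ≤ n := by exact_mod_cast P.hn
  have hf1 : (1 : ℝ) ≤ n ! := by exact_mod_cast Nat.one_le_iff_ne_zero.mpr (Nat.factorial_ne_zero n)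
  have hB : Real.log P.Bexp = P.W - 1 := by unfold Bexp; rw [Real.log_exp]
  have hB1 : 1 ≤ P.Bexp := P.Alast_facts.2.2.2.2.2
  -- `YR/Tf ≤ (5/4)(n+2)^3 n! B N²`
  have hq : P.YR lev / P.Tf lev' ν' ≤ 5 / 4 * ((n : ℝ) + 2) ^ 3 * n ! * P.Bexp * P.N ^ 2 := by
    rw [div_le_iff₀ hT0]
    have h1 : P.YR lev * ((n : ℝ) + 2) ^ 3 ≤ 10 * n * n ! * P.Bexp * P.N ^ 2 * P.L * ((n : ℝ) + 2) ^ 3 :=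
      mul_le_mul_of_nonneg_right hY (by positivity)
    -- `10 n L ≤ (5/4)·8(n+1)L ≤ (5/4)(n+2)^3 Tf`… : `10 n n! B N² L (n+2)^3 ≤ (5/4)(n+2)^3 n! B N² · (n+2)^3 Tf`… use `8(n+1)L ≤ (n+2)^3 Tf`
    have hc : (0 : ℝ) ≤ 5 / 4 * ((n : ℝ) + 2) ^ 3 * n ! * P.Bexp * P.N ^ 2 := by positivity
    have h2 := mul_le_mul_of_nonneg_left hT8 hc
    have h3 : 10 * (n : ℝ) * n ! * P.Bexp * P.N ^ 2 * P.L * ((n : ℝ) + 2) ^ 3 ≤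
        5 / 4 * ((n : ℝ) + 2) ^ 3 * n ! * P.Bexp * P.N ^ 2 * (8 * ((n : ℝ) + 1) * P.L) := by
      have : 10 * (n : ℝ) ≤ 5 / 4 * (8 * ((n : ℝ) + 1)) := by linarith
      have hc2 : (0 : ℝ) ≤ n ! * P.Bexp * P.N ^ 2 * P.L * ((n : ℝ) + 2) ^ 3 := by positivity
      nlinarith [mul_le_mul_of_nonneg_right this hc2]
    have hc3 : (0 : ℝ) < ((n : ℝ) + 2) ^ 3 := by positivity
    nlinarith
  have hbig : (1 : ℝ) ≤ ((n : ℝ) + 2) ^ 3 * n ! * P.Bexp * P.N ^ 2 := by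
    have h27 : (1 : ℝ) ≤ ((n : ℝ) + 2) ^ 3 := one_le_pow₀ (by linarith)
    have hN2 : (1 : ℝ) ≤ P.N ^ 2 := one_le_pow₀ hN.2.1
    exact one_le_mul_of_one_le_of_one_le (one_le_mul_of_one_le_of_one_le (one_le_mul_of_one_le_of_one_le h27 hf1) hB1) hN2
  have h4 : 1 + P.YR lev / P.Tf lev' ν' ≤ 9 / 4 * (((n : ℝ) + 2) ^ 3 * n ! * P.Bexp * P.N ^ 2) := by linarith
  have h5 : Real.log (1 + P.YR lev / P.Tf lev' ν') ≤
      Real.log (9 / 4) + (3 * Real.log ((n : ℝ) + 2) + Real.log (n ! : ℝ) + (P.W - 1) + 2 * Real.log P.N) := by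
    have hpos : 0 < 1 + P.YR lev / P.Tf lev' ν' := by positivity
    calc Real.log (1 + P.YR lev / P.Tf lev' ν') ≤ Real.log (9 / 4 * (((n : ℝ) + 2) ^ 3 * n ! * P.Bexp * P.N ^ 2)) :=
          Real.log_le_log hpos h4
      _ = Real.log (9 / 4) + (3 * Real.log ((n : ℝ) + 2) + Real.log (n ! : ℝ) + (P.W - 1) + 2 * Real.log P.N) := by
          have hB0 : P.Bexp ≠ 0 := by linarith
          have hn2 : ((n : ℝ) + 2) ^ 3 ≠ 0 := by positivity
          have hf0 : (n ! : ℝ) ≠ 0 := by positivity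
          have hN0 : (P.N : ℝ) ^ 2 ≠ 0 := by have := hN.1; positivity
          rw [Real.log_mul (by norm_num) (by positivity), Real.log_mul (by positivity) hN0,
            Real.log_mul (by positivity) hB0, Real.log_mul hn2 hf0, Real.log_pow,
            Real.log_pow, hB]; push_cast; ring
  have h94 : Real.log (9 / 4 : ℝ) ≤ 1 := by
    have : Real.log (9 / 4 : ℝ) ≤ 9 / 4 - 1 := Real.log_le_sub_one_of_pos (by norm_num)
    have h2 : (9 : ℝ) / 4 ≤ Real.exp 1 := by have := Real.exp_one_gt_d9; linarith
    calc Real.log (9 / 4 : ℝ) ≤ Real.log (Real.exp 1) := Real.log_le_log (by norm_num) h2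
      _ = 1 := Real.log_exp 1
  have h6 : 1 + Real.log (1 + P.YR lev / P.Tf lev' ν') ≤ P.WN + Real.log P.N + Real.log (n ! : ℝ) + 3 * Real.log ((n : ℝ) + 2) + 1 := by
    unfold WN; linarith
  exact mul_le_mul_of_nonneg_left h6 hT0.le

end ArchG3Rec

end Summit.ABC.StewartYu
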